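import Mathlib
import HarnessLib
import HarnessLib.Audit
import Summits.AtomisticToContinuum.Crystallization.Statement
import Summits.AtomisticToContinuum.Crystallization.Theses.BrittleRungDescent
import Summits.AtomisticToContinuum.Crystallization.Theses.LaminarSixThreeThree
import Summits.AtomisticToContinuum.Crystallization.Theses.HullMinimality
import Summits.AtomisticToContinuum.Crystallization.Theses.PhononSlackCertificates
import Summits.AtomisticToContinuum.Crystallization.Theses.ReggeStarCoercivity
import Summits.AtomisticToContinuum.Crystallization.Theorems.HullMinimalityHullCriterionConverse
import Summits.AtomisticToContinuum.Crystallization.Theorems.PhononSlackCertificatesWindowOptimality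
import Summits.AtomisticToContinuum.Crystallization.Theorems.PhononSlackCertificatesNearFarGlueRRouteNeeds
import Literature.Geometry.DiscreteGeometry.TwoShellPatterns
import Literature.MathematicalPhysics.StatisticalMechanics.LennardJonesClusters

/-!
# Crux `LJBarlowRigidity` (stmt-AtomisticToContinuum-9206) — line `soft-truss-fractions` (strategist, ALTERNATIVE to `birth`)

Crux (route `BrittleRungDescent`, rank 4): `LJBarlowRigidity := H → Crystallization`, `H` = for some scale
`a > 0`, along every Lennard-Jones ground-state sequence all but `o(N)` particles `i` have a `4a`-ball in which
EVERY particle is softly twelve-kissed at scale `a` (tolerance `1/400`, gap `63a/50`) with an fcc- or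
hcp-pattern soft contact graph (a "`1/400`-soft octet truss" around `i`).

## Why a new line (what the tree already proves — `crystallization_of_isCrystallizing` below, sorry-free)

* `IsCrystallizing lennardJones 3 → Crystallization` is LANDED glue (converse hull criterion 11780 +
  `windowOptimality_proof` 13962 + `CrysEnergyLimit_holds` 0626 + existence): the energetic conjunct is free.
  So the crux is EQUIVALENT to `H → IsCrystallizing lennardJones 3` (`crux_iff_positional`).
* `PhononSlackCertificatesNearFarGlueR.crystallization_of_fractions` is LANDED: the whole sub-problem follows
  from two LOCAL, QUALITATIVE fraction statements about ground states — (F1) the fraction of particles that are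
  not `1/20`-two-shell-good on the window `[47/50, 1]` tends to `0`; (F2) for every `η > 0` the fraction of
  particles whose `2`-ball is not `η`-matched to a box layered template (`PrestressSplitKorn.LayeredNear η`:
  FREE Hägg word, FREE interlayer gaps in `[39a/50, 17a/20]`, `a ∈ [47/50, 1]`) tends to `0`.  Stacking
  selection (`PeriodicGivenLayered_of`), gluing, hull extraction, window optimality are all behind it.
* Consequently birth's stubs 2 (two-scale stacking selection INSIDE finite ground states, XL, its "hardest
  stub") and 3 (energy from windows) are REDUNDANT — birth's stub 1 alone (`H → LaminarBarlowWindows`, item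
  14292) already implies the crux (`PeriodicWindowsSketch.PeriodicWindows_of_laminarBarlowWindows` +
  `PrestressSplitKorn.stub_hullCriterion` + the glue below; see the strategist's `LandedGlue.lean` on the crux).
  This line replaces stub 1 (ε-rigid UNIFORM-Barlow `R`-windows a.e. at EVERY `(R, ε)`, which at `ε → 0`
  secretly re-imports polytype/fault control through the uniform layer spacing) by three statements of which
  only one is analytic, and that one is LOCAL (radius `2`) with free word and free gaps.

## The line: `H ⇒ (F1) ∧ (F2)` under the scale window, then `crystallization_of_fractions`

* `stub_scaleWindow` (A1, SCALE PINNING, M–L, certified lattice sums + bookkeeping): if `H` holds at scale `a`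
  along all LJ ground-state sequences then `943/1000 ≤ a ≤ 997/1000` (true value: bulk bond `0.9686–0.9734`).
  Energy: an a.e.-soft-truss cluster at scale `a` has `E(N)/N ≥ e_truss(a) − o(1)`, and `e_truss(a) − e(hcp*) ≥
  0.027 / 0.015` at the two edges against a `1/400`-distortion slack `|e'(a)|·a/400 ≈ 0.005 / 0.003` and
  `E(N)/N → e* ≤ e(hcp*)`; the window is exactly what (F1)/(F2) need (`a(1 ∓ 1/400) ∈ [47/50, 1]`).
* `stub_twoShellGood` (A2, TRUSS GEOMETRY, M, no energy): a particle whose `4a`-ball is a `1/400`-soft truss,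
  `a` in the window, is `IsTwoShellGood (1/20) (47/50) 1` — combinatorial layer propagation at exact contact
  graphs (the 8 tetrahedra + 6 octahedra around `i` exist: opposite vertices of a square of `j`'s shell have
  the two common neighbours `i`, `q`), metric rigidity of near-regular tetra/octahedra (edges `a(1 ± 1/400)` ⇒
  vertices within `C·a/400`, `C ≲ 4 ≪ 20`), the gap `63a/50` + covering radius `0.71a` exclude strangers within
  `3a/2`; scale `a' := a ∈ [47/50, 1]`.
* `stub_layeredNearAE` (A3, LOCAL FLATNESS a.e., the analytic stub, L): under `H` at a windowed scale, for every
  `η > 0` the fraction of particles whose `2`-ball is not `η`-`LayeredNear` tends to `0`.  For `η ≳ C·a/400` this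
  is A2-type geometry; for `η → 0` it is ELASTIC COERCIVITY IN THE HARMONIC REGIME: every good region is a
  soft truss with cellwise strain `≤ 1/400` (cubic/quadratic ratio `(|V⁽³⁾(1)|/V″(1))/400 = 21/400 ≈ 0.05`), the
  reference (layer-wise relaxed layered set of the region's own word, block-periodised) is a zero-stress
  equilibrium, so the linear term is a null Lagrangian whose boundary flux is `O(|∇u|)·(#surface + C_R·#bad +
  #dislocation-line sites) = o(N)` — across a dislocation cut the flux is `b·σ_ref·area = 0` — and the quadratic
  term is `≥ c Σ_i |sym ∇u_i|²` by Born/phonon stability of the LJ close packings uniformly over words and the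
  box (the harmonic certificate E4 shared with cruxes 13603/14993/9226; drefute numerics on 13603's
  `prestress-split-korn`: interior Korn constant `K_lin → 8.25` over the whole box, all words); the trial bound
  `E(N) − N e* ≤ C N^(2/3)` (`CrysEnergyUpper_holds`) then forces `Σ_i |sym ∇u_i|² = o(N)`, i.e. a.e. `η`-flat
  `2`-balls (free gaps and free word cost nothing here — they ARE the template's freedom).
* `LJBarlowRigidity_of : A1-sig → A2-sig → A3-sig → LJBarlowRigidity` — PROVED below (counting glue
  `tendsto_density_mono` for (F1), A3 for (F2), then `crystallization_of_fractions`).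

`sorry` occurs only inside the three `stub_*`.  Stub signatures are written over importable declarations only
(`H` inlined verbatim as in the route decl; `IsTwoShellGood` from `Literature/Geometry/DiscreteGeometry/TwoShellPatterns`;
`PrestressSplitKorn.LayeredNear` from `Theorems/ReggeStarCoercivityDefectFreeCrystallizesDefs`).

Disproof used: none on file for this crux (no `Disproof.lean`; `ledger crux ls` 2026-08-17).  Negatives index
(Crystallization: 4146, 3506, 15929, 17253): none is an instance of a stub — A1/A3 quantify over LJ ground-state
sequences, A2 is a statement about `1/400`-soft trusses (4146 is a `1/100` LOCAL-HALES statement about shells that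
are NOT given their contact graph; here the graphs are hypotheses).
-/

namespace Summit.AtomisticToContinuum.Crystallization.Cruxes.LJBarlowRigidity.SoftTrussFractions

open Filter
open scoped Classical

/-! ## Landed glue (proved): the sub-problem is its positional conjunct -/

/-- **`IsCrystallizing lennardJones 3 → Crystallization`**, all from LANDED theorems: the converse hull
criterion (`hullCriterionConverse_proof`, item 11780) gives periodic windows of every ground-state
sequence; `windowOptimality_proof` (item 13962) makes their `P` a least element of the periodic energy
per particle; `CrysEnergyLimit_holds` (item 0626) and `LennardJonesGroundStatesExist_holds` turn that
into `HasPeriodicGroundStateEnergy`. [folklore] -/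
theorem crystallization_of_isCrystallizing
    (h : Literature.MathematicalPhysics.StatisticalMechanics.IsCrystallizing Literature.MathematicalPhysics.StatisticalMechanics.lennardJones 3) : _root_.Crystallization := by
  have hPW : Summit.AtomisticToContinuum.Crystallization.Theses.HullMinimality.PeriodicWindows :=
    Summit.AtomisticToContinuum.Crystallization.Theorems.hullCriterionConverse_proof h
  have hWO := Summit.AtomisticToContinuum.Crystallization.Theorems.windowOptimality_proof
  unfold Summit.AtomisticToContinuum.Crystallization.Theses.PhononSlackCertificates.WindowOptimality
    at hWO
  obtain ⟨x, hx⟩ : ∃ x : (N : ℕ) → (Fin N → EuclideanSpace ℝ (Fin 3)), ∀ N, Literature.MathematicalPhysics.StatisticalMechanics.IsGroundState Literature.MathematicalPhysics.StatisticalMechanics.lennardJones (x N) :=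
    ⟨fun N => (Literature.MathematicalPhysics.StatisticalMechanics.LennardJonesGroundStatesExist_holds N).choose,
      fun N => (Literature.MathematicalPhysics.StatisticalMechanics.LennardJonesGroundStatesExist_holds N).choose_spec⟩
  obtain ⟨P, hP⟩ := hPW x hx
  have hleast : IsLeast (Set.range fun Q : Literature.MathematicalPhysics.StatisticalMechanics.PeriodicConfiguration 3 =>
      Q.energyPerParticle Literature.MathematicalPhysics.StatisticalMechanics.lennardJones) (P.energyPerParticle Literature.MathematicalPhysics.StatisticalMechanics.lennardJones) :=
    hWO x hx P hP
  have hinf : (⨅ Q : Literature.MathematicalPhysics.StatisticalMechanics.PeriodicConfiguration 3, Q.energyPerParticle Literature.MathematicalPhysics.StatisticalMechanics.lennardJones) =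
      P.energyPerParticle Literature.MathematicalPhysics.StatisticalMechanics.lennardJones := hleast.csInf_eq
  have h0 := Summit.AtomisticToContinuum.Crystallization.Theses.LaminarSixThreeThree.CrysEnergyLimit_holds
  unfold Summit.AtomisticToContinuum.Crystallization.Theses.LaminarSixThreeThree.CrysEnergyLimit at h0
  rw [hinf] at h0
  exact ⟨⟨P, hleast, h0⟩, h⟩

/-- Hence the crux is EQUIVALENT to `H → IsCrystallizing lennardJones 3`. [folklore] -/
theorem crux_iff_positional : Summit.AtomisticToContinuum.Crystallization.Theses.BrittleRungDescent.LJBarlowRigidity ↔ ((∃ a : ℝ, 0 < a ∧ ∀ x : (N : ℕ) → (Fin N → EuclideanSpace ℝ (Fin 3)), (∀ N, Literature.MathematicalPhysics.StatisticalMechanics.IsGroundState Literature.MathematicalPhysics.StatisticalMechanics.lennardJones (x N)) → Filter.Tendsto (fun N : ℕ => (Nat.card {i : Fin N // ¬ ∀ j : Fin N, dist (x N i) (x N j) ≤ 4 * a → (((∀ l : Fin N, l ≠ j → a * (1 - 1 / 400) ≤ dist (x N j) (x N l) ∧ (dist (x N j) (x N l) ≤ a * (1 + 1 / 400) ∨ 63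 / 50 * a ≤ dist (x N j) (x N l))) ∧ Nat.card {l : Fin N // l ≠ j ∧ dist (x N j) (x N l) ≤ a * (1 + 1 / 400)} = 12) ∧ ((∃ e : {k : Fin N // k ≠ j ∧ dist (x N j) (x N k) ≤ a * (1 + 1 / 400)} ≃ {q : EuclideanSpace ℝ (Fin 3) // q ∈ Literature.Geometry.DiscreteGeometry.fccKissingPattern}, ∀ k k' : {k : Fin N // k ≠ j ∧ dist (x N j) (x N k) ≤ a * (1 + 1 / 400)}, k ≠ k' → (dist (x N k.1) (x N k'.1) ≤ a * (1 + 1 / 400) ↔ dist (e k).1 (e k').1 = 1)) ∨ (∃ e : {k : Fin N // k ≠ j ∧ dist (x N j) (x N k) ≤ a * (1 + 1 / 400)} ≃ {q : EuclideanSpace ℝ (Fin 3) // q ∈ Literature.Geometry.DiscreteGeometry.hcpKissingPattern}, ∀ k k' : {k : Fin N // k ≠ j ∧ dist (x N j) (x N k) ≤ a * (1 + 1 / 400)}, k ≠ k' → (dist (x N k.1) (x N k'.1) ≤ a * (1 + 1 / 400) ↔ dist (e k).1 (e k').1 = 1))))} : ℝ) / N) Filter.atTop (nhds 0)) → Literature.MathematicalPhysics.StatisticalMechanics.IsCrystallizing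 Literature.MathematicalPhysics.StatisticalMechanics.lennardJones 3) :=
  ⟨fun h hH => (h hH).2, fun h hH => crystallization_of_isCrystallizing (h hH)⟩

/-- Counting glue: a pointwise implication of predicates on `Fin N` gives the comparison of the
`Nat.card`s of the complementary subtypes. [folklore] -/
theorem natCard_not_mono {N : ℕ} {B G : Fin N → Prop} (h : ∀ i, B i → G i) :
    Nat.card {i : Fin N // ¬ G i} ≤ Nat.card {i : Fin N // ¬ B i} :=
  Nat.card_le_card_of_injective
    (fun p : {i : Fin N // ¬ G i} => (⟨p.1, fun hB => p.2 (h p.1 hB)⟩ : {i : Fin N // ¬ B i}))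
    (by
      intro p q hpq
      simp only [Subtype.mk.injEq] at hpq
      exact Subtype.ext hpq)

/-- Density glue: if the `B`-bad density tends to `0` and `B ⇒ G` pointwise, the `G`-bad density
tends to `0`. [folklore] -/
theorem tendsto_density_mono (B G : (N : ℕ) → Fin N → Prop) (h : ∀ N i, B N i → G N i)
    (hB : Filter.Tendsto (fun N : ℕ => (Nat.card {i : Fin N // ¬ B N i} : ℝ) / N) Filter.atTop (nhds 0)) :
    Filter.Tendsto (fun N : ℕ => (Nat.card {i : Fin N // ¬ G N i} : ℝ) / N) Filter.atTop (nhds 0) := by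
  refine squeeze_zero (fun N => by positivity) (fun N => ?_) hB
  gcongr
  exact_mod_cast natCard_not_mono (h N)

/-! ## The stubs -/

/-- **A1 — scale pinning.**  If `H` holds at scale `a` along all Lennard-Jones ground-state sequences, then
`943/1000 ≤ a ≤ 997/1000`.  Why plausibly true: a.e. particles are `1/400`-soft-truss vertices at scale `a`
(for every fixed `R`, a.e. particle even has an all-good `R`-ball: particles within `R` of a bad one number
`≤ C_R·#bad = o(N)` by the minimal distance `1/3`), so `E(N) ≥ (N − o(N))·e_truss(a, R) − C·o(N)` with
`e_truss(a, R) ≥ e_Barlow(a) − |∂e/∂a|·a/400 − C R⁻³`, while `E(N)/N → e* ≤ e(hcp at a* ≈ 0.971)`; certified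
two-term hcp/fcc lattice sums give `e_Barlow(0.943) − e(hcp*) ≈ 0.027`, `e_Barlow(0.997) − e(hcp*) ≈ 0.015`
against slacks `≈ 0.005`, `0.003` (and the energy only rises further out).  Vacuous if `H` holds at no scale.
Size M–L (interval lattice sums in the style of `…PeriodicWindowsEnvelopeNumerics`, plus bookkeeping).
Leans on: `LennardJonesMinimalDistance_holds`, `LennardJonesGroundStatesExist_holds`, `CrysEnergyLimit_holds`,
`ChargedEnergyGapNegative.limsup_div_le_energyPerParticle`. -/
theorem stub_scaleWindow : ∀ a : ℝ, 0 < a → (∀ x : (N : ℕ) → (Fin N → EuclideanSpace ℝ (Fin 3)), (∀ N, Literature.MathematicalPhysics.StatisticalMechanics.IsGroundState Literature.MathematicalPhysics.StatisticalMechanics.lennardJones (x N)) → Filter.Tendsto (fun N : ℕ => (Nat.card {i : Fin N // ¬ ∀ j : Fin N, dist (x N i) (x N j) ≤ 4 * a → (((∀ l : Fin N, l ≠ j → a * (1 - 1 / 400) ≤ dist (x N j) (x N l) ∧ (dist (x N j) (x N l) ≤ a * (1 + 1 / 400) ∨ 63 / 50 * a ≤ dist (x N j) (x N l))) ∧ Nat.card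 {l : Fin N // l ≠ j ∧ dist (x N j) (x N l) ≤ a * (1 + 1 / 400)} = 12) ∧ ((∃ e : {k : Fin N // k ≠ j ∧ dist (x N j) (x N k) ≤ a * (1 + 1 / 400)} ≃ {q : EuclideanSpace ℝ (Fin 3) // q ∈ Literature.Geometry.DiscreteGeometry.fccKissingPattern}, ∀ k k' : {k : Fin N // k ≠ j ∧ dist (x N j) (x N k) ≤ a * (1 + 1 / 400)}, k ≠ k' → (dist (x N k.1) (x N k'.1) ≤ a * (1 + 1 / 400) ↔ dist (e k).1 (e k').1 = 1)) ∨ (∃ e : {k : Fin N // k ≠ j ∧ dist (x N j) (x N k) ≤ a * (1 + 1 / 400)} ≃ {q : EuclideanSpace ℝ (Fin 3) // q ∈ Literature.Geometry.DiscreteGeometry.hcpKissingPattern}, ∀ k k' : {k : Fin N // k ≠ j ∧ dist (x N j) (x N k) ≤ a * (1 + 1 / 400)}, k ≠ k' → (dist (x N k.1) (x N k'.1) ≤ a * (1 + 1 / 400) ↔ dist (e k).1 (e k').1 = 1))))} : ℝ) / N) Filter.atTop (nhds 0)) → 943 / 1000 ≤ a ∧ a ≤ 997 / 1000 := by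
  sorry

/-- **A2 — two-shell goodness of a soft-truss vertex (pure geometry).**  If `943/1000 ≤ a ≤ 997/1000` and every
particle within `4a` of `x i` is softly twelve-kissed at scale `a` (tolerance `1/400`, gap `63a/50`) with an fcc-
or hcp-pattern soft contact graph, then `x i` is `IsTwoShellGood (1/20) (47/50) 1` (scale `a`, its own 12 + 6
neighbours as the pattern image).  Why plausibly true: exact contact graphs propagate combinatorially to the 8
tetrahedra + 6 octahedra around `i` (HalesDSP §1.3 made combinatorial; opposite corners of a square face of a
neighbour's shell have exactly two common neighbours); near-regular cells with edges in `a(1 ± 1/400)` are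
`C·a/400`-close to regular ones after a rotation (tetra/octahedra are infinitesimally rigid), `C ≲ 4`, so the 18
points sit within `a/100 ≪ a/20` of `a·A(two-shell pattern)`; no stranger enters `B(x i, 3a/2)` (gap `63a/50`,
covering radius `≈ 0.71a` of the realised truss, kissing lower bound `a(1 − 1/400)` at the covering vertex).
Size M.  Leans on: `TwoShellPatterns` API (`IsTwoShellGood`, `fccTwoShellPattern`, `card = 18`),
`KissingPatterns`/`KissingRigidity`. -/
theorem stub_twoShellGood : ∀ a : ℝ, 943 / 1000 ≤ a → a ≤ 997 / 1000 → ∀ (N : ℕ) (x : Fin N → EuclideanSpace ℝ (Fin 3)) (i : Fin N), Function.Injective x → (∀ j : Fin N, dist (x i) (x j) ≤ 4 * a → (((∀ l : Fin N, l ≠ j → a * (1 - 1 / 400) ≤ dist (x j) (x l) ∧ (dist (x j) (x l) ≤ a * (1 + 1 / 400) ∨ 63 / 50 * a ≤ dist (x j) (x l))) ∧ Nat.card {l : Fin N // l ≠ j ∧ dist (x j) (x l) ≤ a * (1 + 1 / 400)} = 12) ∧ ((∃ e : {k : Fin N // k ≠ j ∧ dist (x j) (x k) ≤ a * (1 + 1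 / 400)} ≃ {q : EuclideanSpace ℝ (Fin 3) // q ∈ Literature.Geometry.DiscreteGeometry.fccKissingPattern}, ∀ k k' : {k : Fin N // k ≠ j ∧ dist (x j) (x k) ≤ a * (1 + 1 / 400)}, k ≠ k' → (dist (x k.1) (x k'.1) ≤ a * (1 + 1 / 400) ↔ dist (e k).1 (e k').1 = 1)) ∨ (∃ e : {k : Fin N // k ≠ j ∧ dist (x j) (x k) ≤ a * (1 + 1 / 400)} ≃ {q : EuclideanSpace ℝ (Fin 3) // q ∈ Literature.Geometry.DiscreteGeometry.hcpKissingPattern}, ∀ k k' : {k : Fin N // k ≠ j ∧ dist (x j) (x k) ≤ a * (1 + 1 / 400)}, k ≠ k' → (dist (x k.1) (x k'.1) ≤ a * (1 + 1 / 400) ↔ dist (e k).1 (e k').1 = 1))))) → Literature.Geometry.DiscreteGeometry.IsTwoShellGood (1 / 20) (47 / 50) 1 x i := by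
  sorry

/-- **A3 — local flatness a.e. (the analytic stub).**  Under `H` at a windowed scale `a`, for every `η > 0`, along
every LJ ground-state sequence the fraction of particles whose `2`-ball is not `η`-`LayeredNear` (two-way
`η`-matched after a rigid motion to a box layered template: free Hägg word, free gaps in `[39a'/50, 17a'/20]`,
`a' ∈ [47/50, 1]`) tends to `0`.  Why plausibly true: for `η ≥ C a/400` it is A2-type geometry (a soft-truss
`2`-ball is `C a/400`-close to the layered template of its own word and gaps; in-window `a` puts `a'`, gaps in
the box); for `η → 0` it is harmonic-regime elastic coercivity: zero-stress layered references (block-periodised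
own word, layer-wise relaxed), null-Lagrangian linear term with `o(N)` boundary flux (surface `N^(2/3)`,
`C_R·#bad`, dislocation lines; cuts carry `b·σ_ref = 0`), quadratic term `≥ c·Σ|sym ∇u|²` by Born/phonon stability
uniform over words and box (certificate-class numerics; 13603's drefute: `K_lin ≤ 8.25`), cubic remainder
`≤ 5 %` of the quadratic at strain `1/400`; the trial bound `E(N) − N e* ≤ C N^(2/3)` (`CrysEnergyUpper_holds`)
gives `Σ|sym ∇u|² = o(N)`, hence a.e. `η`-flat `2`-balls.  Fails iff LJ close packings have a zero-cost
non-affine local mode compatible with the `1/400` truss (excluded numerically: `nker = 6` on every ball) or the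
reference bookkeeping loses an extensive linear term.  Size L.  Leans on: `PrestressSplitKorn.LayeredNear`,
`layeredPos`, `InBox` (Defs of 13603's line), `CrysEnergyUpper_holds`, `LennardJonesMinimalDistance_holds`,
`barlowCoupling`/`barlowSiteEnergy` API. -/
theorem stub_layeredNearAE : ∀ a : ℝ, 943 / 1000 ≤ a → a ≤ 997 / 1000 → (∀ x : (N : ℕ) → (Fin N → EuclideanSpace ℝ (Fin 3)), (∀ N, Literature.MathematicalPhysics.StatisticalMechanics.IsGroundState Literature.MathematicalPhysics.StatisticalMechanics.lennardJones (x N)) → Filter.Tendsto (fun N : ℕ => (Nat.card {i : Fin N // ¬ ∀ j : Fin N, dist (x N i) (x N j) ≤ 4 * a → (((∀ l : Fin N, l ≠ j → a * (1 - 1 / 400) ≤ dist (x N j) (x N l) ∧ (dist (x N j) (x N l) ≤ a * (1 + 1 / 400) ∨ 63 / 50 * a ≤ dist (x N j) (x N l))) ∧ Nat.card {l : Fin N // l ≠ j ∧ dist (x N j) (x N l) ≤ a * (1 + 1 / 400)} = 12) ∧ ((∃ e : {k : Fin N // k ≠ j ∧ dist (x N j) (x N k) ≤ a * (1 + 1 /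 400)} ≃ {q : EuclideanSpace ℝ (Fin 3) // q ∈ Literature.Geometry.DiscreteGeometry.fccKissingPattern}, ∀ k k' : {k : Fin N // k ≠ j ∧ dist (x N j) (x N k) ≤ a * (1 + 1 / 400)}, k ≠ k' → (dist (x N k.1) (x N k'.1) ≤ a * (1 + 1 / 400) ↔ dist (e k).1 (e k').1 = 1)) ∨ (∃ e : {k : Fin N // k ≠ j ∧ dist (x N j) (x N k) ≤ a * (1 + 1 / 400)} ≃ {q : EuclideanSpace ℝ (Fin 3) // q ∈ Literature.Geometry.DiscreteGeometry.hcpKissingPattern}, ∀ k k' : {k : Fin N // k ≠ j ∧ dist (x N j) (x N k) ≤ a * (1 + 1 / 400)}, k ≠ k' → (dist (x N k.1) (x N k'.1) ≤ a * (1 + 1 / 400) ↔ dist (e k).1 (e k').1 = 1))))} : ℝ) / N) Filter.atTop (nhds 0)) → ∀ x : (N : ℕ) → (Fin N → EuclideanSpace ℝ (Fin 3)), (∀ N, Literature.MathematicalPhysics.StatisticalMechanics.IsGroundState Literature.MathematicalPhysics.StatisticalMechanics.lennardJones (x N)) → ∀ η : ℝ, 0 < η → Filter.Tendsto (fun N :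 ℕ => ((Finset.univ.filter fun i : Fin N => ¬ Summit.AtomisticToContinuum.Crystallization.Theorems.PrestressSplitKorn.LayeredNear η (x N) i).card : ℝ) / N) Filter.atTop (nhds 0) := by
  sorry

/-! ## The composition (kernel-checked, no sorry) -/

/-- **The crux BY NAME from the three stub signatures.**  Under `H` take its scale `a`; A1 windows it; for (F1)
the `IsTwoShellGood`-bad particles are among the `H`-bad ones by A2 (`tendsto_density_mono`); (F2) is A3; then
the LANDED `crystallization_of_fractions`. -/
theorem LJBarlowRigidity_of : (∀ a : ℝ, 0 < a → (∀ x : (N : ℕ) → (Fin N → EuclideanSpace ℝ (Fin 3)), (∀ N, Literature.MathematicalPhysics.StatisticalMechanics.IsGroundState Literature.MathematicalPhysics.StatisticalMechanics.lennardJones (x N)) → Filter.Tendsto (fun N : ℕ => (Nat.card {i : Fin N // ¬ ∀ j : Fin N, dist (x N i) (x N j) ≤ 4 * a → (((∀ l : Fin N, l ≠ j → a * (1 - 1 / 400) ≤ dist (x N j) (x N l) ∧ (dist (x N j) (x N l) ≤ a * (1 + 1 / 400) ∨ 63 / 50 * a ≤ dist (x N j) (x N l))) ∧ Nat.card {l :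 Fin N // l ≠ j ∧ dist (x N j) (x N l) ≤ a * (1 + 1 / 400)} = 12) ∧ ((∃ e : {k : Fin N // k ≠ j ∧ dist (x N j) (x N k) ≤ a * (1 + 1 / 400)} ≃ {q : EuclideanSpace ℝ (Fin 3) // q ∈ Literature.Geometry.DiscreteGeometry.fccKissingPattern}, ∀ k k' : {k : Fin N // k ≠ j ∧ dist (x N j) (x N k) ≤ a * (1 + 1 / 400)}, k ≠ k' → (dist (x N k.1) (x N k'.1) ≤ a * (1 + 1 / 400) ↔ dist (e k).1 (e k').1 = 1)) ∨ (∃ e : {k : Fin N // k ≠ j ∧ dist (x N j) (x N k) ≤ a * (1 + 1 / 400)} ≃ {q : EuclideanSpace ℝ (Fin 3) // q ∈ Literature.Geometry.DiscreteGeometry.hcpKissingPattern}, ∀ k k' : {k : Fin N // k ≠ j ∧ dist (x N j) (x N k) ≤ a * (1 + 1 / 400)}, k ≠ k' → (dist (x N k.1) (x N k'.1) ≤ a * (1 + 1 / 400) ↔ dist (e k).1 (e k').1 = 1))))} : ℝ) / N) Filter.atTop (nhds 0)) → 943 / 1000 ≤ a ∧ a ≤ 997 / 1000) → (∀ a : ℝ,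 943 / 1000 ≤ a → a ≤ 997 / 1000 → ∀ (N : ℕ) (x : Fin N → EuclideanSpace ℝ (Fin 3)) (i : Fin N), Function.Injective x → (∀ j : Fin N, dist (x i) (x j) ≤ 4 * a → (((∀ l : Fin N, l ≠ j → a * (1 - 1 / 400) ≤ dist (x j) (x l) ∧ (dist (x j) (x l) ≤ a * (1 + 1 / 400) ∨ 63 / 50 * a ≤ dist (x j) (x l))) ∧ Nat.card {l : Fin N // l ≠ j ∧ dist (x j) (x l) ≤ a * (1 + 1 / 400)} = 12) ∧ ((∃ e : {k : Fin N // k ≠ j ∧ dist (x j) (x k) ≤ a * (1 + 1 / 400)} ≃ {q : EuclideanSpace ℝ (Fin 3) // q ∈ Literature.Geometry.DiscreteGeometry.fccKissingPattern}, ∀ k k' : {k : Fin N // k ≠ j ∧ dist (x j) (x k) ≤ a * (1 + 1 / 400)}, k ≠ k' → (dist (x k.1) (x k'.1) ≤ a * (1 + 1 / 400) ↔ dist (e k).1 (e k').1 = 1)) ∨ (∃ e : {k : Fin N // k ≠ j ∧ dist (x j) (x k) ≤ a * (1 + 1 / 400)} ≃ {q : EuclideanSpace ℝ (Fin 3) //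 q ∈ Literature.Geometry.DiscreteGeometry.hcpKissingPattern}, ∀ k k' : {k : Fin N // k ≠ j ∧ dist (x j) (x k) ≤ a * (1 + 1 / 400)}, k ≠ k' → (dist (x k.1) (x k'.1) ≤ a * (1 + 1 / 400) ↔ dist (e k).1 (e k').1 = 1))))) → Literature.Geometry.DiscreteGeometry.IsTwoShellGood (1 / 20) (47 / 50) 1 x i) → (∀ a : ℝ, 943 / 1000 ≤ a → a ≤ 997 / 1000 → (∀ x : (N : ℕ) → (Fin N → EuclideanSpace ℝ (Fin 3)), (∀ N, Literature.MathematicalPhysics.StatisticalMechanics.IsGroundState Literature.MathematicalPhysics.StatisticalMechanics.lennardJones (x N)) → Filter.Tendsto (fun N : ℕ => (Nat.card {i : Fin N // ¬ ∀ j : Fin N, dist (x N i) (x N j) ≤ 4 * a → (((∀ l : Fin N, l ≠ j → a * (1 - 1 / 400) ≤ dist (x N j) (x N l) ∧ (dist (x N j) (x N l) ≤ a * (1 + 1 / 400) ∨ 63 / 50 * a ≤ dist (x N j) (x N l))) ∧ Nat.card {l : Fin N // l ≠ j ∧ dist (x N j) (x N l) ≤ a * (1 + 1 / 400)} = 12)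 ∧ ((∃ e : {k : Fin N // k ≠ j ∧ dist (x N j) (x N k) ≤ a * (1 + 1 / 400)} ≃ {q : EuclideanSpace ℝ (Fin 3) // q ∈ Literature.Geometry.DiscreteGeometry.fccKissingPattern}, ∀ k k' : {k : Fin N // k ≠ j ∧ dist (x N j) (x N k) ≤ a * (1 + 1 / 400)}, k ≠ k' → (dist (x N k.1) (x N k'.1) ≤ a * (1 + 1 / 400) ↔ dist (e k).1 (e k').1 = 1)) ∨ (∃ e : {k : Fin N // k ≠ j ∧ dist (x N j) (x N k) ≤ a * (1 + 1 / 400)} ≃ {q : EuclideanSpace ℝ (Fin 3) // q ∈ Literature.Geometry.DiscreteGeometry.hcpKissingPattern}, ∀ k k' : {k : Fin N // k ≠ j ∧ dist (x N j) (x N k) ≤ a * (1 + 1 / 400)}, k ≠ k' → (dist (x N k.1) (x N k'.1) ≤ a * (1 + 1 / 400) ↔ dist (e k).1 (e k').1 = 1))))} : ℝ) / N) Filter.atTop (nhds 0)) → ∀ x : (N : ℕ) → (Fin N → EuclideanSpace ℝ (Fin 3)), (∀ N, Literature.MathematicalPhysics.StatisticalMechanics.IsGroundState Literature.MathematicalPhysics.StatisticalMechanics.lennardJones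 (x N)) → ∀ η : ℝ, 0 < η → Filter.Tendsto (fun N : ℕ => ((Finset.univ.filter fun i : Fin N => ¬ Summit.AtomisticToContinuum.Crystallization.Theorems.PrestressSplitKorn.LayeredNear η (x N) i).card : ℝ) / N) Filter.atTop (nhds 0)) → Summit.AtomisticToContinuum.Crystallization.Theses.BrittleRungDescent.LJBarlowRigidity := by
  intro h1 h2 h3
  unfold Summit.AtomisticToContinuum.Crystallization.Theses.BrittleRungDescent.LJBarlowRigidity
  rintro ⟨a, ha, hH⟩
  obtain ⟨hlo, hhi⟩ := h1 a ha hH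
  refine Summit.AtomisticToContinuum.Crystallization.Theorems.PhononSlackCertificatesNearFarGlueR.crystallization_of_fractions ?_ ?_
  · intro x hx
    exact tendsto_density_mono _ _ (fun N i hB => h2 a hlo hhi N (x N) i (hx N).1 hB) (hH x hx)
  · intro x hx η hη
    exact h3 a hlo hhi hH x hx η hη

/-- **The crux from the three stubs** (the only `sorry`s in its cone are the three `stub_*`). -/
theorem LJBarlowRigidity_of_stubs : Summit.AtomisticToContinuum.Crystallization.Theses.BrittleRungDescent.LJBarlowRigidity :=
  LJBarlowRigidity_of stub_scaleWindow stub_twoShellGood stub_layeredNearAE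

/-! ## By-name readings -/

/-- The crux is literally `H → Crystallization` with the `H` inlined in the stubs. -/
example : Summit.AtomisticToContinuum.Crystallization.Theses.BrittleRungDescent.LJBarlowRigidity ↔ ((∃ a : ℝ, 0 < a ∧ ∀ x : (N : ℕ) → (Fin N → EuclideanSpace ℝ (Fin 3)), (∀ N, Literature.MathematicalPhysics.StatisticalMechanics.IsGroundState Literature.MathematicalPhysics.StatisticalMechanics.lennardJones (x N)) → Filter.Tendsto (fun N : ℕ => (Nat.card {i : Fin N // ¬ ∀ j : Fin N, dist (x N i) (x N j) ≤ 4 * a → (((∀ l : Fin N, l ≠ j → a * (1 - 1 / 400) ≤ dist (x N j) (x N l) ∧ (dist (x N j) (x N l) ≤ a * (1 + 1 / 400) ∨ 63 / 50 * a ≤ dist (x N j) (x N l))) ∧ Nat.card {l : Fin N // l ≠ j ∧ dist (x N j) (x N l) ≤ a * (1 + 1 / 400)} = 12) ∧ ((∃ e : {k : Fin N // k ≠ j ∧ dist (x N j) (x N k) ≤ a * (1 + 1 / 400)} ≃ {q : EuclideanSpace ℝ (Fin 3) // q ∈ Literature.Geometry.DiscreteGeometry.fccKissingPattern}, ∀ k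 k' : {k : Fin N // k ≠ j ∧ dist (x N j) (x N k) ≤ a * (1 + 1 / 400)}, k ≠ k' → (dist (x N k.1) (x N k'.1) ≤ a * (1 + 1 / 400) ↔ dist (e k).1 (e k').1 = 1)) ∨ (∃ e : {k : Fin N // k ≠ j ∧ dist (x N j) (x N k) ≤ a * (1 + 1 / 400)} ≃ {q : EuclideanSpace ℝ (Fin 3) // q ∈ Literature.Geometry.DiscreteGeometry.hcpKissingPattern}, ∀ k k' : {k : Fin N // k ≠ j ∧ dist (x N j) (x N k) ≤ a * (1 + 1 / 400)}, k ≠ k' → (dist (x N k.1) (x N k'.1) ≤ a * (1 + 1 / 400) ↔ dist (e k).1 (e k').1 = 1))))} : ℝ) / N) Filter.atTop (nhds 0)) → _root_.Crystallization) := Iff.rfl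

/-- A3's conclusion is VERBATIM hypothesis (F2) of `crystallization_of_fractions`, A2's conclusion feeds (F1). -/
example (hF1 : ∀ x : (N : ℕ) → (Fin N → EuclideanSpace ℝ (Fin 3)), (∀ N, Literature.MathematicalPhysics.StatisticalMechanics.IsGroundState Literature.MathematicalPhysics.StatisticalMechanics.lennardJones (x N)) → Filter.Tendsto (fun N : ℕ => (Nat.card {i : Fin N // ¬ Literature.Geometry.DiscreteGeometry.IsTwoShellGood (1 / 20) (47 / 50) 1 (x N) i} : ℝ) / N) Filter.atTop (nhds 0)) (hF2 : ∀ x : (N : ℕ) → (Fin N → EuclideanSpace ℝ (Fin 3)), (∀ N, Literature.MathematicalPhysics.StatisticalMechanics.IsGroundState Literature.MathematicalPhysics.StatisticalMechanics.lennardJones (x N)) → ∀ η : ℝ, 0 < η → Filter.Tendsto (fun N : ℕ => ((Finset.univ.filter fun i : Fin N => ¬ Summit.AtomisticToContinuum.Crystallization.Theorems.PrestressSplitKorn.LayeredNear η (x N) i).card : ℝ) / N) Filter.atTop (nhds 0)) : _root_.Crystallization :=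
  Summit.AtomisticToContinuum.Crystallization.Theorems.PhononSlackCertificatesNearFarGlueR.crystallization_of_fractions hF1 hF2

end Summit.AtomisticToContinuum.Crystallization.Cruxes.LJBarlowRigidity.SoftTrussFractions
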